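import Mathlib

/-! # Stub `stub_h1Estimate` of line `Sketch` for crux `TameOrBrodyR4` (stmt-SmoothPoincare4-7826, route SullivanDual)

The constant-coefficient `H¹` ("energy") inequality for the linear Cauchy–Riemann operator
`P W = ∂₂ W - A₀ ∂₁ W` on `ℂ = ℝ²` (`∂₁ = d·(1) = ∂/∂x`, `∂₂ = d·(i) = ∂/∂y`): for a constant
`A₀ : ℝ⁴ →L[ℝ] ℝ⁴` with `A₀² = -1` and a compactly supported `C^∞` map `W : ℂ → ℝ⁴`,

`∫ ‖∂₁W‖² + ‖∂₂W‖² ≤ (1 + ‖A₀‖²) ∫ ‖∂₂W - A₀ ∂₁W‖²`.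

Proof.  Put `m(u, v) := ⟪u, v⟫ + ⟪A₀ u, A₀ v⟫`; then `‖u‖² ≤ m(u, u) ≤ (1 + ‖A₀‖²) ‖u‖²`
(operator norm), `m(A₀ u, A₀ u) = m(u, u)` (because `A₀² = -1`) and
`m(u, A₀ v) = ⟪u, A₀ v⟫ - ⟪A₀ u, v⟫`.  With `a := ∂₂W(z)`, `b := ∂₁W(z)` this gives the pointwise
inequality (`H1Estimate.pointwise`)
`‖b‖² + ‖a‖² ≤ (1 + ‖A₀‖²) ‖a - A₀ b‖² + 2 (⟪a, A₀ b⟫ - ⟪A₀ a, b⟫)`.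
Integrating, it remains to see that `∫ ⟪∂₂W, A₀ ∂₁W⟫ = ∫ ⟪A₀ ∂₂W, ∂₁W⟫` (`H1Estimate.cross_eq`):
integrating by parts (Mathlib's `integral_bilinear_fderiv_right_eq_neg_left_of_integrable` for the
bilinear form `(p, q) ↦ ⟪A₀ p, q⟫`, once in the direction `i` and once in the direction `1`,
`H1Estimate.ibp`) both sides equal `-∫ ⟪A₀ ∂₂∂₁W, W⟫`, by the symmetry of second derivatives
(`ContDiffAt.isSymmSndFDerivAt`).  All integrands are continuous with compact support, hence
integrable.  Uses Mathlib only.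
-/

noncomputable section

open scoped ContDiff Topology InnerProductSpace
open Filter Set MeasureTheory

-- the registered namespace `Summit.SmoothPoincare4.SmoothPoincare4.…` repeats a component
set_option linter.dupNamespace false

namespace Summit.SmoothPoincare4.SmoothPoincare4.Cruxes.TameOrBrodyR4.Sketch

/-- Local notation for the model space `ℝ⁴ = EuclideanSpace ℝ (Fin 4)`. -/
local notation "E4" => EuclideanSpace ℝ (Fin 4)

namespace H1Estimate

section Support

variable {G : Type*} [NormedAddCommGroup G]

/-- A continuous combination `m (p z) (q z)` of two compactly supported maps `p q : ℂ → G`, with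
`m 0 0 = 0`, is integrable (it is continuous with compact support). -/
theorem integrable_comp₂ {p q : ℂ → G} (hpc : HasCompactSupport p) (hqc : HasCompactSupport q)
    (m : G → G → ℝ) (hm : Continuous fun z => m (p z) (q z)) (h0 : m 0 0 = 0) :
    Integrable (fun z => m (p z) (q z)) :=
  hm.integrable_of_hasCompactSupport (hpc.comp₂_left hqc h0)

end Support

variable {F : Type*} [NormedAddCommGroup F] [InnerProductSpace ℝ F]

/-! ### Pointwise algebra -/

/-- The pointwise inequality behind the `H¹` estimate: for `A₀² = -1` and all `a b`,
`‖b‖² + ‖a‖² ≤ (1 + ‖A₀‖²) ‖a - A₀ b‖² + 2 (⟪a, A₀ b⟫ - ⟪A₀ a, b⟫)`.  Indeed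
`‖a - A₀ b‖² + ‖A₀ (a - A₀ b)‖² = ‖a - A₀ b‖² + ‖A₀ a + b‖²
  = ‖a‖² + ‖b‖² + ‖A₀ a‖² + ‖A₀ b‖² - 2 ⟪a, A₀ b⟫ + 2 ⟪A₀ a, b⟫`
and `‖A₀ (a - A₀ b)‖ ≤ ‖A₀‖ ‖a - A₀ b‖`. -/
theorem pointwise (A₀ : F →L[ℝ] F) (hA₀ : ∀ v, A₀ (A₀ v) = -v) (a b : F) :
    ‖b‖ ^ 2 + ‖a‖ ^ 2 ≤
      (1 + ‖A₀‖ ^ 2) * ‖a - A₀ b‖ ^ 2 + 2 * (⟪a, A₀ b⟫_ℝ - ⟪A₀ a, b⟫_ℝ) := by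
  have h1 : ‖a - A₀ b‖ ^ 2 = ‖a‖ ^ 2 - 2 * ⟪a, A₀ b⟫_ℝ + ‖A₀ b‖ ^ 2 := norm_sub_sq_real a (A₀ b)
  have h2 : A₀ (a - A₀ b) = A₀ a + b := by rw [map_sub, hA₀, sub_neg_eq_add]
  have h3 : ‖A₀ (a - A₀ b)‖ ^ 2 = ‖A₀ a‖ ^ 2 + 2 * ⟪A₀ a, b⟫_ℝ + ‖b‖ ^ 2 := by
    rw [h2]; exact norm_add_sq_real (A₀ a) b
  have h4 : ‖A₀ (a - A₀ b)‖ ^ 2 ≤ ‖A₀‖ ^ 2 * ‖a - A₀ b‖ ^ 2 := by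
    rw [← mul_pow]
    exact pow_le_pow_left₀ (norm_nonneg _) (A₀.le_opNorm _) 2
  nlinarith [sq_nonneg ‖A₀ a‖, sq_nonneg ‖A₀ b‖]

/-! ### Calculus on `ℂ = ℝ²` for compactly supported smooth maps -/

section Calculus

variable {W : ℂ → F}

/-- The directional derivatives `z ↦ dW(z) v` of a `C^∞` map are `C^∞`. -/
theorem contDiff_fderiv_apply (hW : ContDiff ℝ ∞ W) (v : ℂ) :
    ContDiff ℝ ∞ fun z => fderiv ℝ W z v :=
  (contDiff_infty_iff_fderiv.1 hW).2.clm_apply contDiff_const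

/-- The directional derivatives `z ↦ dW(z) v` of a `C^∞` map are continuous. -/
theorem continuous_fderiv_apply (hW : ContDiff ℝ ∞ W) (v : ℂ) :
    Continuous fun z => fderiv ℝ W z v :=
  (contDiff_fderiv_apply hW v).continuous

/-- Iterated directional derivatives are values of the second derivative:
`∂_w (z ↦ dW(z) v) = d²W(z) w v`. -/
theorem fderiv_fderiv_apply (hW : ContDiff ℝ ∞ W) (v w z : ℂ) :
    fderiv ℝ (fun x => fderiv ℝ W x v) z w = fderiv ℝ (fderiv ℝ W) z w v := by
  have hd : DifferentiableAt ℝ (fderiv ℝ W) z :=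
    ((contDiff_infty_iff_fderiv.1 hW).2.differentiable (by simp)).differentiableAt
  rw [fderiv_clm_apply hd (differentiableAt_const v)]
  simp

/-- Symmetry of second derivatives of a `C^∞` map: `∂₁ ∂₂ W = ∂₂ ∂₁ W`, written with
directional derivatives `∂_v W = (z ↦ dW(z) v)`. -/
theorem fderiv_fderiv_comm (hW : ContDiff ℝ ∞ W) (v w z : ℂ) :
    fderiv ℝ (fun x => fderiv ℝ W x v) z w = fderiv ℝ (fun x => fderiv ℝ W x w) z v := by
  rw [fderiv_fderiv_apply hW, fderiv_fderiv_apply hW]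
  exact (hW.contDiffAt.isSymmSndFDerivAt
    (minSmoothness_of_isRCLikeNormedField.trans_le ENat.LEInfty.out)) w v

/-- **Integration by parts** for the bilinear form `(p, q) ↦ ⟪A₀ p, q⟫` and a compactly supported
`C^∞` map `W : ℂ → F`: `∫ ⟪A₀ ∂_w W, ∂_v W⟫ = -∫ ⟪A₀ ∂_v ∂_w W, W⟫`. -/
theorem ibp (A₀ : F →L[ℝ] F) (hW : ContDiff ℝ ∞ W) (hWc : HasCompactSupport W) (v w : ℂ) :
    ∫ z, ⟪A₀ (fderiv ℝ W z w), fderiv ℝ W z v⟫_ℝ =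
      -∫ z, ⟪A₀ (fderiv ℝ (fun x => fderiv ℝ W x w) z v), W z⟫_ℝ := by
  have hWd : Differentiable ℝ W := hW.differentiable (by simp)
  have h1 : ContDiff ℝ ∞ fun x => fderiv ℝ W x w := contDiff_fderiv_apply hW w
  have h1c : HasCompactSupport fun x => fderiv ℝ W x w := hWc.fderiv_apply ℝ w
  have h2c : HasCompactSupport fun x => fderiv ℝ (fun x => fderiv ℝ W x w) x v :=
    h1c.fderiv_apply ℝ v
  have hvc : HasCompactSupport fun x => fderiv ℝ W x v := hWc.fderiv_apply ℝ v
  have hc0 : Continuous W := hW.continuous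
  have hc1 : Continuous fun x => fderiv ℝ W x w := h1.continuous
  have hc2 : Continuous fun x => fderiv ℝ (fun x => fderiv ℝ W x w) x v :=
    continuous_fderiv_apply h1 v
  have hcv : Continuous fun x => fderiv ℝ W x v := continuous_fderiv_apply hW v
  have hf'g : Integrable fun x => ⟪A₀ (fderiv ℝ (fun x => fderiv ℝ W x w) x v), W x⟫_ℝ :=
    integrable_comp₂ h2c hWc (fun p q => ⟪A₀ p, q⟫_ℝ) (by fun_prop) (by simp)
  have hfg' : Integrable fun x => ⟪A₀ (fderiv ℝ W x w), fderiv ℝ W x v⟫_ℝ :=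
    integrable_comp₂ h1c hvc (fun p q => ⟪A₀ p, q⟫_ℝ) (by fun_prop) (by simp)
  have hfg : Integrable fun x => ⟪A₀ (fderiv ℝ W x w), W x⟫_ℝ :=
    integrable_comp₂ h1c hWc (fun p q => ⟪A₀ p, q⟫_ℝ) (by fun_prop) (by simp)
  exact integral_bilinear_fderiv_right_eq_neg_left_of_integrable (μ := (volume : Measure ℂ))
    (B := ((innerSL ℝ).comp A₀ : F →L[ℝ] F →L[ℝ] ℝ)) (f := fun x => fderiv ℝ W x w) (g := W)
    (v := v) hf'g hfg' hfg (fun x _ => (h1.differentiable (by simp)).differentiableAt)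
    (fun x _ => (hWd x))

/-- The cross term of the `H¹` identity: `∫ ⟪∂₂W, A₀ ∂₁W⟫ = ∫ ⟪A₀ ∂₂W, ∂₁W⟫`; after integrating
by parts both sides are `-∫ ⟪A₀ ∂₂∂₁W, W⟫`, by the symmetry of second derivatives. -/
theorem cross_eq (A₀ : F →L[ℝ] F) (hW : ContDiff ℝ ∞ W) (hWc : HasCompactSupport W) :
    ∫ z, ⟪fderiv ℝ W z Complex.I, A₀ (fderiv ℝ W z 1)⟫_ℝ =
      ∫ z, ⟪A₀ (fderiv ℝ W z Complex.I), fderiv ℝ W z 1⟫_ℝ := by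
  have hX := ibp A₀ hW hWc Complex.I 1
  have hY := ibp A₀ hW hWc 1 Complex.I
  calc ∫ z, ⟪fderiv ℝ W z Complex.I, A₀ (fderiv ℝ W z 1)⟫_ℝ
      = ∫ z, ⟪A₀ (fderiv ℝ W z 1), fderiv ℝ W z Complex.I⟫_ℝ := by
        congr 1; ext z; exact real_inner_comm _ _
    _ = -∫ z, ⟪A₀ (fderiv ℝ (fun x => fderiv ℝ W x 1) z Complex.I), W z⟫_ℝ := hX
    _ = -∫ z, ⟪A₀ (fderiv ℝ (fun x => fderiv ℝ W x Complex.I) z 1), W z⟫_ℝ := by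
        congr 1; congr 1; ext z; rw [fderiv_fderiv_comm hW Complex.I 1 z]
    _ = ∫ z, ⟪A₀ (fderiv ℝ W z Complex.I), fderiv ℝ W z 1⟫_ℝ := hY.symm

end Calculus

/-! ### Assembly -/

/-- Integrated form of `H1Estimate.pointwise`: if `a b : ℂ → F` are continuous with compact
support and the cross term `∫ ⟪a, A₀ b⟫ - ⟪A₀ a, b⟫` vanishes, then
`∫ ‖b‖² + ‖a‖² ≤ (1 + ‖A₀‖²) ∫ ‖a - A₀ b‖²`. -/
theorem integral_le (A₀ : F →L[ℝ] F) (hA₀ : ∀ v, A₀ (A₀ v) = -v) {a b : ℂ → F}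
    (ha : Continuous a) (hb : Continuous b) (hac : HasCompactSupport a)
    (hbc : HasCompactSupport b)
    (hcross : ∫ z, ⟪a z, A₀ (b z)⟫_ℝ = ∫ z, ⟪A₀ (a z), b z⟫_ℝ) :
    (∫ z, (‖b z‖ ^ 2 + ‖a z‖ ^ 2)) ≤ (1 + ‖A₀‖ ^ 2) * ∫ z, ‖a z - A₀ (b z)‖ ^ 2 := by
  have hi1 : Integrable fun z => ‖b z‖ ^ 2 + ‖a z‖ ^ 2 :=
    integrable_comp₂ hac hbc (fun x y => ‖y‖ ^ 2 + ‖x‖ ^ 2) (by fun_prop) (by simp)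
  have hi2 : Integrable fun z => ‖a z - A₀ (b z)‖ ^ 2 :=
    integrable_comp₂ hac hbc (fun x y => ‖x - A₀ y‖ ^ 2) (by fun_prop) (by simp)
  have hi3 : Integrable fun z => ⟪a z, A₀ (b z)⟫_ℝ :=
    integrable_comp₂ hac hbc (fun x y => ⟪x, A₀ y⟫_ℝ) (by fun_prop) (by simp)
  have hi4 : Integrable fun z => ⟪A₀ (a z), b z⟫_ℝ :=
    integrable_comp₂ hac hbc (fun x y => ⟪A₀ x, y⟫_ℝ) (by fun_prop) (by simp)
  calc ∫ z, (‖b z‖ ^ 2 + ‖a z‖ ^ 2)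
      ≤ ∫ z, ((1 + ‖A₀‖ ^ 2) * ‖a z - A₀ (b z)‖ ^ 2 +
          2 * (⟪a z, A₀ (b z)⟫_ℝ - ⟪A₀ (a z), b z⟫_ℝ)) :=
        integral_mono hi1 ((hi2.const_mul _).fun_add ((hi3.sub' hi4).const_mul _))
          fun z => pointwise A₀ hA₀ (a z) (b z)
    _ = ((1 + ‖A₀‖ ^ 2) * ∫ z, ‖a z - A₀ (b z)‖ ^ 2) +
          2 * ((∫ z, ⟪a z, A₀ (b z)⟫_ℝ) - ∫ z, ⟪A₀ (a z), b z⟫_ℝ) := by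
        rw [integral_add (hi2.const_mul _) ((hi3.sub' hi4).const_mul _), integral_const_mul,
          integral_const_mul, integral_sub hi3 hi4]
    _ = (1 + ‖A₀‖ ^ 2) * ∫ z, ‖a z - A₀ (b z)‖ ^ 2 := by
        rw [hcross, sub_self, mul_zero, add_zero]

end H1Estimate

/-- **The constant-coefficient `H¹` identity for the linear Cauchy–Riemann operator.** For a
constant `A₀ : ℝ⁴ → ℝ⁴` with `A₀² = -1` and a compactly supported `C^∞` map `W : ℂ → ℝ⁴`, with
`∂₁ = ∂/∂x = d·(1)` and `∂₂ = ∂/∂y = d·(i)`: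
`∫ ‖∂₁W‖² + ‖∂₂W‖² ≤ (1 + ‖A₀‖²) ∫ ‖∂₂W - A₀ ∂₁W‖²`.
Proof: integrate the pointwise inequality `H1Estimate.pointwise` (with `a = ∂₂W(z)`,
`b = ∂₁W(z)`); the cross term `∫ ⟪∂₂W, A₀ ∂₁W⟫ - ⟪A₀ ∂₂W, ∂₁W⟫` vanishes by two integrations
by parts and the symmetry of second derivatives (`H1Estimate.cross_eq`). -/
theorem stub_h1Estimate (A₀ : E4 →L[ℝ] E4) (hA₀ : ∀ v, A₀ (A₀ v) = -v) (W : ℂ → E4)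
    (hW : ContDiff ℝ ∞ W) (hWc : HasCompactSupport W) :
    (∫ z, (‖fderiv ℝ W z 1‖ ^ 2 + ‖fderiv ℝ W z Complex.I‖ ^ 2)) ≤
      (1 + ‖A₀‖ ^ 2) * ∫ z, ‖fderiv ℝ W z Complex.I - A₀ (fderiv ℝ W z 1)‖ ^ 2 :=
  H1Estimate.integral_le A₀ hA₀ (H1Estimate.continuous_fderiv_apply hW Complex.I)
    (H1Estimate.continuous_fderiv_apply hW 1) (hWc.fderiv_apply ℝ Complex.I)
    (hWc.fderiv_apply ℝ 1) (H1Estimate.cross_eq A₀ hW hWc)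

end Summit.SmoothPoincare4.SmoothPoincare4.Cruxes.TameOrBrodyR4.Sketch
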